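import Literature.Geometry.Kaehler.ComplexTorusLefschetzGroupConnectedAlbertTypes
import HarnessLib

/-!
# `S(X)` is connected iff `X` is not of type III — unconditionally in dimension `g ≤ 7`, `4 ∤ g`
# (`g ∈ {1, 2, 3, 5, 6, 7}`: a type-IV endomorphism algebra then has `d = 1`, since `e₀ d² ∣ g`)

Layer `Literature/Geometry/Kaehler`, namespace `Literature.Geometry.Kaehler.ComplexTorus`; lane `lit-hodgefound`
(Track 2 foundations library), Layer A4 (Lefschetz groups), skeleton seat `lit-hodgefound-skel-4` (generation 35),
row A4-94 (e). Sequel BY NAME of `ComplexTorusLefschetzGroupConnectedAlbertTypes` (row A4-94 (d):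
`IsSimple.lefschetzIdentityC_eq_lefschetzGroupC_iff_not_isAlbertTypeIII` under «type IV ⟹ `d = 1`»,
`IsIsogenous.lefschetzIdentityC_eq_lefschetzGroupC_iff_forall_not_isAlbertTypeIII_of_powers`), of
`ComplexTorusAlbertClassificationLowDimension` / `ComplexTorusAbelianSurfaceEndomorphismAlgebras` (p12:
`IsSimple.finrank_centerField_endAlgRat_eq_one_or_eq_four_of_finrank_le_seven`, `IsSimple.finrank_centerField_mul_finrank_dvd`
— `e·[F : K] ∣ 2g`) and Mathlib's `NumberField.IsCMField` (`[K : K⁺] = 2`). THEOREMS ONLY (no definition, no named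
fact; net debt 0).

## Sources, verbatim

* [Lange2023AbelianVarietiesComplex] H. Lange, *Abelian Varieties over the Complex Numbers* (2023), §2.6.1, the
  Proposition (p. 138), table: «`(F, ′)` of the second kind ∣ `d` ∣ `½e` ∣ `e₀d²` ∣ `e₀d² ∣ g`» — a type-IV simple
  abelian variety with `d = 2` has `4 ∣ g`.
* [Milne1999LefschetzClasses] J. S. Milne, *Lefschetz classes on abelian varieties*, Duke Math. J. 96 (1999), §2
  Summary table (p. 652): «I ∣ Sp ∣ Yes ∣ Yes; II ∣ Sp ∣ Yes ∣ Yes; III ∣ O ∣ Yes ∣ No; IV ∣ GL ∣ No ∣ Yes»;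
  Remark 4.9 («When `A` has an isogeny factor of type III …»).
* [MoonenZarhin1999LowDim] B. Moonen, Yu. Zarhin, *Hodge classes on abelian varieties of low dimension* (1999), §2
  (the case lists for `g ≤ 5`).

## What is proved

* `IsSimple.finrank_centerField_endAlgRat_eq_one_of_isAlbertTypeIV_of_not_four_dvd`: for a simple polarised complex
  torus of dimension `g ≤ 7` with `4 ∤ g`, a type-IV endomorphism algebra is the CM field itself (`[E : K] = 1`):
  `[E : K] ∈ {1, 4}` by counting, and `[E : K] = 4` would give `8 ∣ e·4 ∣ 2g` (`e = [K : ℚ]` is even for a CM field).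
* **`IsSimple.lefschetzIdentityC_eq_lefschetzGroupC_iff_not_isAlbertTypeIII_of_not_four_dvd`** — for `g ≤ 7`,
  `4 ∤ g`: `Lf(X)(ℂ) = S(X)(ℂ) ⟺ X` is not of Albert type III, with NO hypothesis on the endomorphism algebra; and the
  isogeny-product form **`IsIsogenous.lefschetzIdentityC_eq_lefschetzGroupC_iff_forall_not_isAlbertTypeIII_of_powers_of_not_four_dvd`**
  («`S(X)` connected ⟺ no factor of type III», all simple factors of dimension `≤ 7` not divisible by `4`).
-/

noncomputable section

open Matrix Module NumberField
open Literature.RingTheory.CentralSimple (IsAlbertTypeIII IsAlbertTypeIV)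

namespace Literature.Geometry.Kaehler

namespace ComplexTorus

/-! ## §1 Simple tori of dimension `g ≤ 7`, `4 ∤ g` -/

section Simple

variable {κ : Type} [Fintype κ] [DecidableEq κ] [Nonempty κ] {E : Type*} [NormedAddCommGroup E] [NormedSpace ℂ E]
  [FiniteDimensional ℂ E] {Ψ : (κ → ℝ) ≃L[ℝ] E} {η : E [⋀^Fin 2]→L[ℝ] ℝ} {G : Matrix κ κ ℚ}

/-- **A type-IV simple torus of dimension `g ≤ 7` with `4 ∤ g` has `[End_ℚ(X) : K] = 1`** («`e₀d² ∣ g`»: `d = 2`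
forces `4 ∣ g`; here from `e·[E : K] ∣ 2g`, `[E : K] ∈ {1, 4}` and `e = [K : ℚ] = 2[K⁺ : ℚ]` for the CM centre `K`).
[cite: Lange2023AbelianVarietiesComplex, §2.6.1 Proposition (table, «restriction» column: `e₀d² ∣ g`)] -/
theorem IsSimple.finrank_centerField_endAlgRat_eq_one_of_isAlbertTypeIV_of_not_four_dvd (hX : IsSimple Ψ)
    (hη : IsRiemannForm Ψ η) (hG : G.map (Rat.cast : ℚ → ℝ) = latticeGram Ψ η) (hg : finrank ℂ E ≤ 7)
    (h4 : ¬ 4 ∣ finrank ℂ E) (h : IsAlbertTypeIV (centerField Ψ hX) (endAlgRat Ψ) (rosatiEnd Ψ hη.1 hη.2.2 hG)) :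
    finrank (centerField Ψ hX) (endAlgRat Ψ) = 1 := by
  rcases hX.finrank_centerField_endAlgRat_eq_one_or_eq_four_of_finrank_le_seven hg with h1 | hfour
  · exact h1
  · exfalso
    have hdvd := hX.finrank_centerField_mul_finrank_dvd
    rw [hfour] at hdvd
    haveI := h.isCMField
    have h2 : 2 ∣ finrank ℚ (centerField Ψ hX) := by
      rw [← finrank_mul_finrank ℚ (maximalRealSubfield (centerField Ψ hX)) (centerField Ψ hX),
        Algebra.IsQuadraticExtension.finrank_eq_two (maximalRealSubfield (centerField Ψ hX)) (centerField Ψ hX)]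
      exact Dvd.intro_left _ rfl
    obtain ⟨a, ha⟩ := h2
    obtain ⟨c, hc⟩ := hdvd
    refine h4 ⟨a * c, Nat.eq_of_mul_eq_mul_left (by norm_num : 0 < 2) ?_⟩
    rw [hc, ha]
    ring

/-- **`Lf(X)(ℂ) = S(X)(ℂ)` for a simple polarised complex torus of dimension `g ≤ 7`, `4 ∤ g`, which is not of Albert
type III** (no hypothesis on the endomorphism algebra). [cite: Milne1999LefschetzClasses, §2 Summary table (p. 652)]
[cite: Lange2023AbelianVarietiesComplex, §2.6.1 Proposition] -/
theorem IsSimple.lefschetzIdentityC_eq_lefschetzGroupC_of_not_isAlbertTypeIII_of_not_four_dvd (hX : IsSimple Ψ)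
    (hη : IsRiemannForm Ψ η) (hG : G.map (Rat.cast : ℚ → ℝ) = latticeGram Ψ η) (hg : finrank ℂ E ≤ 7)
    (h4 : ¬ 4 ∣ finrank ℂ E) (hIII : ¬ IsAlbertTypeIII (centerField Ψ hX) (endAlgRat Ψ) (rosatiEnd Ψ hη.1 hη.2.2 hG)) :
    lefschetzIdentityC Ψ G = lefschetzGroupC Ψ G :=
  hX.lefschetzIdentityC_eq_lefschetzGroupC_of_not_isAlbertTypeIII hη hG hg hIII
    (hX.finrank_centerField_endAlgRat_eq_one_of_isAlbertTypeIV_of_not_four_dvd hη hG hg h4)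

/-- **Milne's table as an unconditional equivalence in dimension `g ≤ 7`, `4 ∤ g` (`g = 1, 2, 3, 5, 6, 7`):
`Lf(X)(ℂ) = S(X)(ℂ)` iff the simple polarised torus `X` is not of Albert type III.**
[cite: Milne1999LefschetzClasses, §2 Summary table (p. 652) and Remark 4.9] [cite: Lange2023AbelianVarietiesComplex, §2.6.1 Proposition]
[cite: MoonenZarhin1999LowDim, §2] -/
theorem IsSimple.lefschetzIdentityC_eq_lefschetzGroupC_iff_not_isAlbertTypeIII_of_not_four_dvd (hX : IsSimple Ψ)
    (hη : IsRiemannForm Ψ η) (hG : G.map (Rat.cast : ℚ → ℝ) = latticeGram Ψ η) (hg : finrank ℂ E ≤ 7)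
    (h4 : ¬ 4 ∣ finrank ℂ E) :
    lefschetzIdentityC Ψ G = lefschetzGroupC Ψ G ↔
      ¬ IsAlbertTypeIII (centerField Ψ hX) (endAlgRat Ψ) (rosatiEnd Ψ hη.1 hη.2.2 hG) :=
  hX.lefschetzIdentityC_eq_lefschetzGroupC_iff_not_isAlbertTypeIII hη hG hg
    (hX.finrank_centerField_endAlgRat_eq_one_of_isAlbertTypeIV_of_not_four_dvd hη hG hg h4)

end Simple

/-! ## §2 Isogeny products -/

section IsogenyFactors

variable {K : Type*} [Fintype K] [DecidableEq K] {σ : K → Type} [∀ k, Fintype (σ k)] [∀ k, DecidableEq (σ k)]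
  [∀ k, Nonempty (σ k)] {F : K → Type*} [∀ k, NormedAddCommGroup (F k)] [∀ k, NormedSpace ℂ (F k)]
  [∀ k, FiniteDimensional ℂ (F k)] {Ψ : ∀ k, (σ k → ℝ) ≃L[ℝ] F k} {ω : ∀ k, F k [⋀^Fin 2]→L[ℝ] ℝ}
  {G : ∀ k, Matrix (σ k) (σ k) ℚ} {n : K → ℕ}
  {ι : Type*} [Fintype ι] [DecidableEq ι] {E : Type*} [NormedAddCommGroup E] [NormedSpace ℂ E]
  {Φ : (ι → ℝ) ≃L[ℝ] E} {η : E [⋀^Fin 2]→L[ℝ] ℝ} {G₀ : Matrix ι ι ℚ}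

/-- **«`S(X)` IS CONNECTED IFF `X` HAS NO ISOGENY FACTOR OF TYPE III», unconditionally for factors of dimension
`≤ 7` not divisible by `4`:** for `X ∼ ∏ B_k^{n_k}` (simple `B_k`, `Hom_ℚ(B_k, B_l) = 0` for `k ≠ l`, `n_k ≥ 1`,
`dim B_k ∈ {1, 2, 3, 5, 6, 7}`), `Lf(X)(ℂ) = S(X)(ℂ) ⟺` no `B_k` is of Albert type III.
[cite: Milne1999LefschetzClasses, §1 Prop. 1.5, §2 Summary table (p. 652) and Remark 4.9 (p. 661)]
[cite: Lange2023AbelianVarietiesComplex, §2.6.1 Proposition] -/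
theorem IsIsogenous.lefschetzIdentityC_eq_lefschetzGroupC_iff_forall_not_isAlbertTypeIII_of_powers_of_not_four_dvd
    (hX : IsIsogenous Φ (sigmaPiPeriod fun k ↦ powPeriod (Ψ k) (n k))) (hη : IsRiemannForm Φ η)
    (hG₀ : G₀.map (Rat.cast : ℚ → ℝ) = latticeGram Φ η) (h : ∀ k, IsRiemannForm (Ψ k) (ω k))
    (hG : ∀ k, (G k).map (Rat.cast : ℚ → ℝ) = latticeGram (Ψ k) (ω k))
    (hhom : ∀ k l, k ≠ l → homRat (Ψ l) (Ψ k) = ⊥) (hn : ∀ k, 0 < n k) (hs : ∀ k, IsSimple (Ψ k))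
    (hg : ∀ k, finrank ℂ (F k) ≤ 7) (h4 : ∀ k, ¬ 4 ∣ finrank ℂ (F k)) :
    lefschetzIdentityC Φ G₀ = lefschetzGroupC Φ G₀ ↔
      ∀ k, ¬ IsAlbertTypeIII (centerField (Ψ k) (hs k)) (endAlgRat (Ψ k)) (rosatiEnd (Ψ k) (h k).1 (h k).2.2 (hG k)) :=
  hX.lefschetzIdentityC_eq_lefschetzGroupC_iff_forall_not_isAlbertTypeIII_of_powers hη hG₀ h hG hhom hn hs hg fun k ↦
    (hs k).finrank_centerField_endAlgRat_eq_one_of_isAlbertTypeIV_of_not_four_dvd (h k) (hG k) (hg k) (h4 k)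

/-- The same, sufficiency form: no type-III factor (dimensions `≤ 7`, `4 ∤ dim B_k`) ⟹ `Lf(X)(ℂ) = S(X)(ℂ)`.
[cite: Milne1999LefschetzClasses, §1 Prop. 1.5 and §2 Summary table (p. 652)] -/
theorem IsIsogenous.lefschetzIdentityC_eq_lefschetzGroupC_of_powers_of_forall_not_isAlbertTypeIII_of_not_four_dvd
    (hX : IsIsogenous Φ (sigmaPiPeriod fun k ↦ powPeriod (Ψ k) (n k))) (hη : IsRiemannForm Φ η)
    (hG₀ : G₀.map (Rat.cast : ℚ → ℝ) = latticeGram Φ η) (h : ∀ k, IsRiemannForm (Ψ k) (ω k))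
    (hG : ∀ k, (G k).map (Rat.cast : ℚ → ℝ) = latticeGram (Ψ k) (ω k))
    (hhom : ∀ k l, k ≠ l → homRat (Ψ l) (Ψ k) = ⊥) (hn : ∀ k, 0 < n k) (hs : ∀ k, IsSimple (Ψ k))
    (hg : ∀ k, finrank ℂ (F k) ≤ 7) (h4 : ∀ k, ¬ 4 ∣ finrank ℂ (F k))
    (hIII : ∀ k, ¬ IsAlbertTypeIII (centerField (Ψ k) (hs k)) (endAlgRat (Ψ k)) (rosatiEnd (Ψ k) (h k).1 (h k).2.2 (hG k))) :
    lefschetzIdentityC Φ G₀ = lefschetzGroupC Φ G₀ :=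
  (hX.lefschetzIdentityC_eq_lefschetzGroupC_iff_forall_not_isAlbertTypeIII_of_powers_of_not_four_dvd hη hG₀ h hG hhom
    hn hs hg h4).2 hIII

end IsogenyFactors

end ComplexTorus

end Literature.Geometry.Kaehler
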